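import Summits.Ventures.PercRepro.Night2LocalRuleGoodTwo
import Summits.Ventures.PercRepro.Night2ShapeOneMainB

/-!
# night-2: thin faces are coloops, and a lossy set needs three of them

In cell `(2, 1)` (two points off `G`, one coloop `K` of `G`) every thin face of a set `S ⊆ G` is `S.erase w` for a
coloop `w` of `S ∖ K` (`thin_coverPreimages_subset_image_coloops`) and requests at most `Φ/4 = 7/24`; so
`L1 S ≤ |coloops (S ∖ K)| · 7/24`, and a set with at most two coloops off `K` has `L1 ≤ 7/12 < 11/18 ≤ capS`: it is
not lossy — every `loss B z` with `insert z B` such a set vanishes, and with it every share of `dshGT2` (and of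
`dshGT`) from that pair.  This is the arithmetic core of "a distance-2 target receives no distance-1 share".
-/

namespace PercRepro.Shadow

open PercRepro.ThmH PercRepro.PerFlat

variable {α : Type*} [DecidableEq α] {M : Matroid α} [M.Finite] {G : Finset α}

/-- A thin member of cell `(2, ·)` requests at most `7/24`: its closure misses at least two points of `G`. -/
theorem req_le_seven_div_24_of_thin (hG : G ∈ flatsQ M (5 + 1)) (hd : (gr M \ G).card = 2) {F : Finset α}
    (hthin : F ∈ thinMembers M 5 G) : req M 5 F ≤ 7 / 24 := by
  have hd' : (gr M \ G).card ≤ 5 := by omega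
  have hm := two_le_card_sdiff_of_not_lay0 hG hd' (mem_thinMembers.1 hthin).1 (mem_thinMembers.1 hthin).2
  rw [req_eq_of_thin hG hthin, hd]
  have hm' : (2 : ℚ) ≤ ((G \ clF M F).card : ℚ) := by exact_mod_cast hm
  unfold phiQ
  rw [div_le_iff₀ (by linarith)]
  linarith

/-- `L1 S ≤ |coloops (S ∖ K)| · 7/24`: the thin faces of `S` inject into the coloops of `S ∖ K`. -/
theorem L1_le_card_coloops_mul (hG : G ∈ flatsQ M (5 + 1)) (hd : (gr M \ G).card = 2) (S : Finset α) :
    L1 M 5 G S ≤ ((coloops M (S \ coloops M G)).card : ℚ) * (7 / 24) := by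
  have hd' : (gr M \ G).card ≤ 5 := by omega
  unfold L1
  have hsub := thin_coverPreimages_subset_image_coloops hG hd' S
  calc ∑ F ∈ (coverPreimages M (Uq M (5 + 2) 5) G S).filter (fun F => F ∉ lay0 M 5 G), req M 5 F
      ≤ ∑ _F ∈ (coverPreimages M (Uq M (5 + 2) 5) G S).filter (fun F => F ∉ lay0 M 5 G), (7 / 24 : ℚ) := by
        apply Finset.sum_le_sum
        intro F hF
        rw [Finset.mem_filter, mem_coverPreimages] at hF
        exact req_le_seven_div_24_of_thin hG hd (mem_thinMembers.2 ⟨hF.1.1, hF.2⟩)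
    _ = (((coverPreimages M (Uq M (5 + 2) 5) G S).filter (fun F => F ∉ lay0 M 5 G)).card : ℚ) * (7 / 24) := by
        rw [Finset.sum_const, nsmul_eq_mul]
    _ ≤ ((coloops M (S \ coloops M G)).card : ℚ) * (7 / 24) := by
        gcongr
        exact (Finset.card_le_card hsub).trans Finset.card_image_le

/-- A set with at most two coloops off `K` has `L1 ≤ 7/12`. -/
theorem L1_le_of_card_coloops_le_two (hG : G ∈ flatsQ M (5 + 1)) (hd : (gr M \ G).card = 2) {S : Finset α}
    (h : (coloops M (S \ coloops M G)).card ≤ 2) : L1 M 5 G S ≤ 7 / 12 := by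
  have h1 := L1_le_card_coloops_mul hG hd S
  have h2 : ((coloops M (S \ coloops M G)).card : ℚ) ≤ 2 := by exact_mod_cast h
  linarith

/-- A set with at most two coloops off `K` is not lossy: `fS = 1`. -/
theorem fS_eq_one_of_card_coloops_le_two (hG : G ∈ flatsQ M (5 + 1)) (hd : (gr M \ G).card = 2)
    (hk : kColoops M G = 1) {S : Finset α} (hSG : S ⊆ G) (h : (coloops M (S \ coloops M G)).card ≤ 2) :
    fS M 5 G S = 1 := by
  have hL := L1_le_of_card_coloops_le_two hG hd h
  have hc := capS_ge_eleven_eighteenths_two_one hd hk hSG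
  unfold fS
  rw [if_pos (by linarith)]

/-- **No loss from a pair whose set has at most two coloops off `K`.** -/
theorem loss_eq_zero_of_card_coloops_le_two (hG : G ∈ flatsQ M (5 + 1)) (hd : (gr M \ G).card = 2)
    (hk : kColoops M G = 1) {B : Finset α} {z : α} (hQG : insert z B ⊆ G)
    (h : (coloops M (insert z B \ coloops M G)).card ≤ 2) : loss M 5 G B z = 0 := by
  unfold loss
  rw [fS_eq_one_of_card_coloops_le_two hG hd hk hQG h]
  ring

/-- A pair without loss sends nothing under `dshGT2`. -/
theorem dshGT2_eq_zero_of_loss_eq_zero {q : ℕ} {B : Finset α} {z : α} (h : loss M q G B z = 0) (S : Finset α) :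
    dshGT2 M q G B z S = 0 := by
  unfold dshGT2 dshMissed
  rw [h]
  split_ifs <;> simp

/-- A pair without loss sends nothing under `dshGT`. -/
theorem dshGT_eq_zero_of_loss_eq_zero {q : ℕ} {B : Finset α} {z : α} (h : loss M q G B z = 0) (S : Finset α) :
    dshGT M q G B z S = 0 := by
  unfold dshGT dshMissed
  rw [h]
  split_ifs <;> simp

/-- A pair whose set has at most two coloops off `K` sends nothing under `dshGT2`. -/
theorem dshGT2_eq_zero_of_card_coloops_le_two (hG : G ∈ flatsQ M (5 + 1)) (hd : (gr M \ G).card = 2)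
    (hk : kColoops M G = 1) {B : Finset α} {z : α} (hQG : insert z B ⊆ G)
    (h : (coloops M (insert z B \ coloops M G)).card ≤ 2) (S : Finset α) : dshGT2 M 5 G B z S = 0 :=
  dshGT2_eq_zero_of_loss_eq_zero (loss_eq_zero_of_card_coloops_le_two hG hd hk hQG h) S

end PercRepro.Shadow
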